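import Mathlib
import Summits.ValiantsHypothesis.ValiantsHypothesis.Theses.GaugeDescent
import Summits.ValiantsHypothesis.ValiantsHypothesis.Theorems.GaugeDescentDescentGlueTransfer
import Summits.ValiantsHypothesis.ValiantsHypothesis.Theorems.GaugeDescentDescentGlueDescent
import Summits.ValiantsHypothesis.ValiantsHypothesis.Theorems.GaugeDescentDescentGlueIntegral
import Summits.ValiantsHypothesis.ValiantsHypothesis.Theorems.GaugeDescentDescentGlueBadPrimes
import Summits.ValiantsHypothesis.ValiantsHypothesis.Theorems.GaugeDescentDescentGluePrimes
import Summits.ValiantsHypothesis.ValiantsHypothesis.Theorems.GaugeDescentDescentGlueResidue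
import Literature.Computability.AlgebraicComplexity.BurgisserThm45Proofs
import Literature.Computability.AlgebraicComplexity.BurgisserBooleanPartsA3Steps
import Literature.Computability.AlgebraicComplexity.ValiantConjectureProofs
import Literature.Computability.AlgebraicComplexity.RealTauConjectureDepthFour
import Summits.ValiantsHypothesis.ValiantsHypothesis.Theorems.LangWeilTransferAssemblyPrelims
import HarnessLib

/-!
# Route GaugeDescent — `DescentGlue` (stmt-ValiantsHypothesis-6637): `GeomRigidity → PrimeFieldTransfer`

The glue of the route: IF some optimal skeleton for `per_n` is torus-rigid (crux `GeomRigidity`,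
OPEN) then, under `VP_ℂ = VNP_ℂ`, for every p-bounded `ℓ` there are p-bounded `r, s` and, for
every `n`, a prime `2^{ℓ(n)} < p ≤ 2^{r(n)}` with `L_{ℤ/p}(per_n) ≤ s(n)` (`PrimeFieldTransfer`,
GRH-free). Proof = the item's recipe, assembled from parts A–F
(`GaugeDescentDescentGlue{Transfer,Descent,Integral,BadPrimes,Primes,Residue}.lean`):
`VP = VNP` ⇒ `L_ℂ(per_n)` p-bounded (`perFamily_mem_VNP_holds`); `GeomRigidity` ⇒ skeleton `Q`,
torus `A`, `≤ q(n)` orbits covering `R_n = {y : Q(x,y) = per_n}`; the slot system of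
`Q(x,y) = per_n` (part A) is solvable, so Bürgisser's Thm. 4.5
(`algebraicSolution_height_bound_holds`) gives a small algebraic point `z = λ⁻¹ v(θ) ∈ R_n`; part C
descends the orbit of `z` to a number field `K`, `[K:ℚ] ≤ q(n)`, with `y_v = ∏ z_w^{B v w}`; part
D: `M^e y_v` algebraic integers for `M = |lc g| λ ∏ max(1, |Res(g, v_w)|)`, `ω(M) ≤ 2^{b(n)}`
(part D′); part F: a prime `2^{ℓ(n)} < p ≤ 2^{2(ℓ(n)+b(n)+4)}`, `p ∤ M`; part E:
`L_{ℤ/p}(per_n) ≤ (5q³+6q²+2q)·m + 3q`. Small `n`: Bertrand prime and the constant-free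
complexity of `per_n` over `ℤ`. (`weight (per_n) ≤ n!` is reused from
`LangWeilTransferAssemblyPrelims.lean`, val-lit p6.)

Honest framing: this closes a SUPPORT item of a conditional route whose cruxes (`GeomRigidity`,
`NP ⊄ P/poly`) are open problems; `VP ≠ VNP` is NOT proved and nothing here is progress on it.
-/

set_option linter.dupNamespace false

noncomputable section

namespace Summit.ValiantsHypothesis.ValiantsHypothesis.Theorems.GaugeDescent

open MvPolynomial Finset Literature.Computability.AlgebraicComplexity

namespace DescentGlue

/-! ### Arithmetic of the exponents -/

/-- `2^X + Y + 1 ≤ 2^(X + Y + 1)`. [folklore] -/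
theorem two_pow_add_le (X Y : ℕ) : (2 : ℝ) ^ X + Y + 1 ≤ (2 : ℝ) ^ (X + Y + 1) := by
  have h1 : (Y : ℝ) + 2 ≤ (2 : ℝ) ^ (Y + 1) := by
    have : Y + 2 ≤ 2 ^ (Y + 1) := Nat.lt_two_pow_self (n := Y + 1)
    exact_mod_cast this
  have h2 : (1 : ℝ) ≤ (2 : ℝ) ^ X := one_le_pow₀ one_le_two
  rw [show X + Y + 1 = X + (Y + 1) by omega, pow_add]
  nlinarith [mul_nonneg (sub_nonneg.mpr h2) (sub_nonneg.mpr (show (1 : ℝ) ≤ (2 : ℝ) ^ (Y + 1) from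
    one_le_pow₀ one_le_two))]

/-- The exponent bookkeeping: `4 (μ+1) T² log w ≤ 2^b` for `T ≤ a 2^{(m+1) a m}`, `μ ≤ m`,
`log w ≤ 2^m + N + 1`, with `b = 2(m+1)·a·m + 2a + 2m + N + 4`. [folklore] -/
theorem exponent_bound (a m μ N : ℕ) (hμ : μ ≤ m) {T Lw : ℝ} (hT0 : 0 ≤ T)
    (hT : T ≤ a * (2 : ℝ) ^ ((m + 1) * (a * m))) (hLw0 : 0 ≤ Lw)
    (hLw : Lw ≤ (2 : ℝ) ^ m + N + 1) :
    4 * ((μ : ℝ) + 1) * T ^ 2 * Lw ≤ (2 : ℝ) ^ (2 * ((m + 1) * (a * m)) + 2 * a + 2 * m + N + 4) := by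
  have h1 : 4 * ((μ : ℝ) + 1) ≤ (2 : ℝ) ^ (m + 3) := by
    have : (m : ℝ) + 1 ≤ (2 : ℝ) ^ (m + 1) := by
      have h := (Nat.lt_two_pow_self (n := m + 1)).le
      exact_mod_cast h
    have hμm : (μ : ℝ) ≤ m := by exact_mod_cast hμ
    rw [show m + 3 = (m + 1) + 2 by omega, pow_add]
    nlinarith
  have h2 : T ^ 2 ≤ (2 : ℝ) ^ (2 * ((m + 1) * (a * m)) + 2 * a) := by
    have ha : (a : ℝ) ≤ (2 : ℝ) ^ a := by exact_mod_cast (Nat.lt_two_pow_self).le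
    calc T ^ 2 ≤ (a * (2 : ℝ) ^ ((m + 1) * (a * m))) ^ 2 := pow_le_pow_left₀ hT0 hT 2
      _ ≤ ((2 : ℝ) ^ a * (2 : ℝ) ^ ((m + 1) * (a * m))) ^ 2 :=
          pow_le_pow_left₀ (by positivity) (mul_le_mul_of_nonneg_right ha (by positivity)) 2
      _ = (2 : ℝ) ^ (2 * ((m + 1) * (a * m)) + 2 * a) := by
          rw [← pow_add, ← pow_mul]; congr 1; ring
  have h3 : Lw ≤ (2 : ℝ) ^ (m + N + 1) := hLw.trans (two_pow_add_le m N)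
  calc 4 * ((μ : ℝ) + 1) * T ^ 2 * Lw
      ≤ (2 : ℝ) ^ (m + 3) * (2 : ℝ) ^ (2 * ((m + 1) * (a * m)) + 2 * a) * (2 : ℝ) ^ (m + N + 1) := by
        refine mul_le_mul (mul_le_mul h1 h2 (by positivity) (by positivity)) h3 hLw0 (by positivity)
    _ = (2 : ℝ) ^ (2 * ((m + 1) * (a * m)) + 2 * a + 2 * m + N + 4) := by
        rw [← pow_add, ← pow_add]; congr 1; ring

/-! ### Small ingredients -/

/-- `VP_ℂ = VNP_ℂ` makes the complexity of the permanent p-bounded. [cite: Valiant1979] -/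
theorem isPBounded_complexity_perPoly_of_VP_eq_VNP (h : VP ℂ = VNP ℂ) :
    IsPBounded fun n => complexity (perPoly (Fin n) ℂ) := by
  have hVNP : perFamily ℂ ∈ VNP ℂ := perFamily_mem_VNP_holds ℂ
  rw [← h] at hVNP
  have hVP : IsVPFamily (fun n => perPoly (Fin n) ℂ) :=
    (mem_VP_ofFintype_iff_holds (k := ℂ) (σ := fun n => Fin n × Fin n) _).mp hVNP
  exact hVP.2

/-- `per_n` over `ZMod p` never costs more than the constant-free complexity of `per_n` over `ℤ`.
[cite: Burgisser2000, §4.1] -/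
theorem complexity_perPoly_zmod_le_constantFree (n p : ℕ) :
    complexity (perPoly (Fin n) (ZMod p)) ≤ constantFreeComplexity (perPoly (Fin n) ℤ) := by
  rw [← map_perPoly (Int.castRingHom (ZMod p))]
  exact ArithCircuit.complexity_map_le_constantFreeComplexity _ _

/-! ### The main case: one `n` with a rigid skeleton -/

/-- **One rigid skeleton gives a good prime.** For a fan-in-two sign-constant integer skeleton `Q`
with `≤ μ` slots whose solution variety `{y : Q(x,y) = per_n}` is covered by the torus orbits of
`N ≥ 1` points, and the constant `a` of Bürgisser's Thm. 4.5: for every `ℓ` there is a prime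
`2^ℓ < p ≤ 2^{2(ℓ + b + 4)}` with `L_{ℤ/p}(per_n) ≤ (5N³+6N²+2N)|Q| + 3N`, where
`b = 2(m+1)am + 2a + 2m + n² + 4` for any `m ≥ μ, |Q|`. [cite: Burgisser2000TCS, Thm. 4.5 and §5 (A3)] -/
theorem exists_prime_of_rigid_skeleton {a : ℕ}
    (ha : ∀ (n s d w : ℕ) (S : Fin s → MvPolynomial (Fin n) ℤ),
      n < d → (∀ i, (S i).totalDegree ≤ d) → (∀ i, weight (S i) ≤ w) →
      (∃ z : Fin n → ℂ, ∀ i, aeval z (S i) = 0) →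
      ∃ (lam : ℕ) (v : Fin n → Polynomial ℤ) (g : Polynomial ℤ) (y : ℂ),
        0 < lam ∧ Irreducible g ∧ g.IsPrimitive ∧ 0 < g.natDegree ∧ Polynomial.aeval y g = 0 ∧
        (∀ i, aeval (fun j => (lam : ℂ)⁻¹ * Polynomial.aeval y (v j)) (S i) = 0) ∧
        (g.natDegree : ℝ) ≤ a * (d : ℝ) ^ (a * n) ∧
        (∀ j, ((v j).natDegree : ℝ) ≤ a * (d : ℝ) ^ (a * n)) ∧
        Real.log lam ≤ a * (d : ℝ) ^ (a * n) * Real.log w ∧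
        Real.log (polyWeight g) ≤ a * (d : ℝ) ^ (a * n) * Real.log w ∧
        ∀ j, Real.log (polyWeight (v j)) ≤ a * (d : ℝ) ^ (a * n) * Real.log w)
    {n μ k N m : ℕ} (Q : ArithCircuit ℤ ((Fin n × Fin n) ⊕ Fin μ)) (A : Fin k → Fin μ → ℤ)
    (pts : Fin N → Fin μ → ℂ) (hμ : μ ≤ m) (hQ2 : Q.IsFanInTwo) (hQc : Q.HasSignConstants)
    (hQs : Q.size ≤ m) (hN : 0 < N)
    (hcover : ∀ (i : Fin N) (t : Fin k → ℂˣ),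
      aeval (Sum.elim X fun v => C (((∏ l, t l ^ A l v : ℂˣ) : ℂ) * pts i v)) Q.eval =
        perPoly (Fin n) ℂ)
    (hexhaust : ∀ y : Fin μ → ℂ, aeval (Sum.elim X fun v => C (y v)) Q.eval = perPoly (Fin n) ℂ →
      ∃ (i : Fin N) (t : Fin k → ℂˣ), ∀ v, y v = ((∏ l, t l ^ A l v : ℂˣ) : ℂ) * pts i v)
    (ℓ : ℕ) :
    ∃ p : ℕ, p.Prime ∧ 2 ^ ℓ < p ∧
      p ≤ 2 ^ (2 * (ℓ + (2 * ((m + 1) * (a * m)) + 2 * a + 2 * m + n * n + 4) + 4)) ∧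
      complexity (perPoly (Fin n) (ZMod p)) ≤ (5 * N ^ 3 + 6 * N ^ 2 + 2 * N) * m + 3 * N := by
  classical
  -- §1 the slot system and its solvability
  set T : MvPolynomial (Fin n × Fin n) ℤ := perPoly (Fin n) ℤ with hT
  set S := slotSystem Q.eval T with hS
  have hidZ : ∀ y : Fin μ → ℂ, aeval (Sum.elim X fun v => C (y v)) Q.eval = perPoly (Fin n) ℂ ↔
      ∀ i, aeval y (S i) = 0 := by
    intro y
    rw [← map_perPoly (Int.castRingHom ℂ), hS, hT]
    exact aeval_sumElim_eq_map_iff_slotSystem Q.eval (perPoly (Fin n) ℤ) y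
  have hsol : ∃ z : Fin μ → ℂ, ∀ i, aeval z (S i) = 0 := by
    refine ⟨pts ⟨0, hN⟩, (hidZ _).mp ?_⟩
    have := hcover ⟨0, hN⟩ 1
    simpa using this
  -- §2 degree and weight bounds
  set d : ℕ := 2 ^ (m + 1) with hd
  set w : ℕ := 2 ^ 2 ^ m + n.factorial with hw
  have hμd : μ < d := by
    calc μ ≤ m := hμ
      _ < 2 ^ m := Nat.lt_two_pow_self
      _ ≤ 2 ^ (m + 1) := Nat.pow_le_pow_right two_pos (by omega)
  have hdegS : ∀ i, (S i).totalDegree ≤ d := fun i =>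
    (totalDegree_slotSystem_le _ _ i).trans ((totalDegree_eval_le_two_pow_size hQ2).trans
      (Nat.pow_le_pow_right two_pos (by omega)))
  have hwtS : ∀ i, weight (S i) ≤ w := fun i =>
    (weight_slotSystem_le _ _ i).trans (Nat.add_le_add
      ((weight_eval_le_two_pow_two_pow_size hQ2 hQc).trans
        (Nat.pow_le_pow_right two_pos (Nat.pow_le_pow_right two_pos hQs)))
      (LangWeilTransfer.weight_perPoly_le n))
  -- §3 Bürgisser's small solution
  obtain ⟨lam, v, g, θ, hlam, hirr, hprim, hdeg, hθ, hz, hg1, hv1, hlam2, hg2, hv2⟩ :=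
    ha μ _ d w S hμd hdegS hwtS hsol
  set z : Fin μ → ℂ := fun j => (lam : ℂ)⁻¹ * Polynomial.aeval θ (v j) with hzdef
  have hzR : aeval (Sum.elim X fun v => C (z v)) Q.eval = perPoly (Fin n) ℂ := (hidZ z).mpr hz
  -- §4 `z` is algebraic
  have hθQ : IsIntegral ℚ θ := by
    refine IsAlgebraic.isIntegral ⟨g.map (algebraMap ℤ ℚ), ?_, ?_⟩
    · exact (Polynomial.map_ne_zero_iff (algebraMap ℤ ℚ).injective_int).mpr hirr.ne_zero
    · rw [Polynomial.aeval_map_algebraMap]; exact hθ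
  have hzalg : ∀ j, IsAlgebraic ℚ (z j) := by
    intro j
    apply IsIntegral.isAlgebraic
    have h1 : IsIntegral ℚ (Polynomial.aeval θ (v j)) := by
      rw [← Polynomial.aeval_map_algebraMap ℚ, Polynomial.aeval_eq_sum_range]
      exact IsIntegral.sum _ fun i _ => (hθQ.pow i).smul _
    have h2 : IsIntegral ℚ ((lam : ℂ)⁻¹) := by
      have := isIntegral_algebraMap (R := ℚ) (A := ℂ) (x := ((lam : ℚ))⁻¹)
      rwa [map_inv₀, map_natCast] at this
    exact h2.mul h1
  -- §5 Galois descent of the orbit of `z`, monomial form (part C)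
  let SQ : Set (MvPolynomial (Fin μ) ℚ) := Set.range fun i => MvPolynomial.map (Int.castRingHom ℚ) (S i)
  have hSQ : ∀ y : Fin μ → ℂ, (∀ f ∈ SQ, aeval y f = 0) ↔ ∀ i, aeval y (S i) = 0 := by
    intro y
    have key : ∀ i, aeval y (MvPolynomial.map (Int.castRingHom ℚ) (S i)) = aeval y (S i) := by
      intro i
      rw [show Int.castRingHom ℚ = algebraMap ℤ ℚ from rfl, aeval_map_algebraMap]
    constructor
    · intro h i
      rw [← key i]
      exact h _ ⟨i, rfl⟩
    · rintro h f ⟨i, rfl⟩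
      rw [key i]
      exact h i
  have H1 : ∀ (i : Fin N) (t : Fin k → ℂˣ), ∀ f ∈ SQ,
      aeval (fun v => ((∏ l, t l ^ A l v : ℂˣ) : ℂ) * pts i v) f = 0 := fun i t =>
    (hSQ _).mpr ((hidZ _).mp (hcover i t))
  have H2 : ∀ y : Fin μ → ℂ, (∀ f ∈ SQ, aeval y f = 0) →
      ∃ (i : Fin N) (t : Fin k → ℂˣ), ∀ v, y v = ((∏ l, t l ^ A l v : ℂˣ) : ℂ) * pts i v :=
    fun y hy => hexhaust y ((hidZ y).mpr ((hSQ y).mp hy))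
  obtain ⟨K, y, B, t, hKfd, hKN, hyK, hyR, -, hB0, hy0, hymon⟩ :=
    exists_numberField_monomial_point μ k N SQ A pts H1 H2 z hzalg ((hSQ z).mpr hz)
  haveI := hKfd
  have hyid : aeval (Sum.elim X fun v => C (y v)) Q.eval = perPoly (Fin n) ℂ :=
    (hidZ y).mpr ((hSQ y).mp hyR)
  -- §6 integrality away from `M` (part D)
  set M : ℕ := g.leadingCoeff.natAbs * lam * ∏ w, max 1 (Polynomial.resultant g (v w)).natAbs
    with hMdef
  have hM0 : 0 < M := den_pos hlam v hirr.ne_zero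
  have hint : ∀ a', ∃ e : ℕ, IsIntegral ℤ ((M : ℂ) ^ e * y a') :=
    exists_integral_denominator hlam v hirr hdeg hθ B y hB0 hy0 hymon
  -- §7 few bad primes (part D′) and the exponent arithmetic
  set Tr : ℝ := a * (d : ℝ) ^ (a * μ) with hTr
  have hT1 : 1 ≤ Tr := by
    have : (1 : ℝ) ≤ g.natDegree := by exact_mod_cast hdeg
    exact this.trans hg1
  have hcardR := card_primeFactors_den_le hlam v hirr.ne_zero (T := Tr) (Lw := Real.log w) hT1
    hg1 hv1 hlam2 hg2 hv2
  -- `Tr ≤ a 2^{(m+1) a m}` and `log w ≤ 2^m + n² + 1`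
  have hTr_le : Tr ≤ a * (2 : ℝ) ^ ((m + 1) * (a * m)) := by
    rw [hTr, hd]
    push_cast
    rw [← pow_mul]
    refine mul_le_mul_of_nonneg_left (pow_le_pow_right₀ one_le_two ?_) (Nat.cast_nonneg _)
    exact Nat.mul_le_mul_left _ (Nat.mul_le_mul_left _ hμ)
  have hw1 : (1 : ℝ) ≤ w := by
    rw [hw]; exact_mod_cast (Nat.one_le_two_pow).trans (Nat.le_add_right _ _)
  have hLw0 : 0 ≤ Real.log w := Real.log_nonneg hw1
  have hLw : Real.log w ≤ (2 : ℝ) ^ m + (n * n : ℕ) + 1 := by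
    -- `w ≤ 2^(2^m + n² + 1)` and `log 2 ≤ 1`
    have hfac : n.factorial ≤ 2 ^ (n * n) := by
      calc n.factorial ≤ n ^ n := Nat.factorial_le_pow n
        _ ≤ (2 ^ n) ^ n := Nat.pow_le_pow_left (Nat.lt_two_pow_self).le n
        _ = 2 ^ (n * n) := by rw [← pow_mul]
    have hwle : w ≤ 2 ^ (2 ^ m + n * n + 1) := by
      rw [hw, pow_succ]
      have h1 : 2 ^ 2 ^ m ≤ 2 ^ (2 ^ m + n * n) := Nat.pow_le_pow_right two_pos (by omega)
      have h2 : 2 ^ (n * n) ≤ 2 ^ (2 ^ m + n * n) := Nat.pow_le_pow_right two_pos (by omega)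
      omega
    have hwR : (w : ℝ) ≤ (2 : ℝ) ^ (2 ^ m + n * n + 1) := by exact_mod_cast hwle
    calc Real.log w ≤ Real.log ((2 : ℝ) ^ (2 ^ m + n * n + 1)) :=
          Real.log_le_log (by positivity) hwR
      _ = (2 ^ m + n * n + 1 : ℕ) * Real.log 2 := by rw [Real.log_pow]
      _ ≤ (2 ^ m + n * n + 1 : ℕ) * 1 :=
          mul_le_mul_of_nonneg_left (Real.log_two_lt_d9.le.trans (by norm_num)) (Nat.cast_nonneg _)
      _ = (2 : ℝ) ^ m + (n * n : ℕ) + 1 := by push_cast; ring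
  set b : ℕ := 2 * ((m + 1) * (a * m)) + 2 * a + 2 * m + n * n + 4 with hb
  have hcard : M.primeFactors.card ≤ 2 ^ b := by
    have h := hcardR.trans (exponent_bound a m μ (n * n) hμ (zero_le_one.trans hT1) hTr_le hLw0 hLw)
    rw [← hMdef] at h
    exact_mod_cast h
  -- §8 a good prime (part F) and the bound over `ZMod p` (part E)
  obtain ⟨p, hp, hpl, hpr, hpM⟩ := exists_good_prime ℓ b M hM0 hcard
  haveI : Fact p.Prime := ⟨hp⟩
  refine ⟨p, hp, hpl, by rw [hb] at hpr; exact hpr, ?_⟩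
  have hE := complexity_perPoly_zmod_le_of_point K Q hQ2 y hyK hyid M hM0 hint p hpM
  refine hE.trans ?_
  have hD : Module.finrank ℚ K ≤ N := hKN
  calc (5 * Module.finrank ℚ K ^ 3 + 6 * Module.finrank ℚ K ^ 2 + 2 * Module.finrank ℚ K) * Q.size +
        3 * Module.finrank ℚ K
      ≤ (5 * N ^ 3 + 6 * N ^ 2 + 2 * N) * m + 3 * N := by gcongr

/-! ### Assembly -/

/-- **`DescentGlue` (stmt-ValiantsHypothesis-6637): `GeomRigidity → PrimeFieldTransfer`.** See the
module docstring. [cite: Burgisser2000TCS, Thm. 4.5 and §5 (A3)] -/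
theorem descentGlue_proof :
    Summit.ValiantsHypothesis.ValiantsHypothesis.Theses.GaugeDescent.DescentGlue := by
  intro hGR hVP ℓ hℓ
  classical
  have hper := isPBounded_complexity_perPoly_of_VP_eq_VNP hVP
  obtain ⟨m, q, hm, hq, hev⟩ := hGR _ hper (fun n => le_rfl)
  obtain ⟨n₀, hn₀⟩ := Filter.eventually_atTop.mp hev
  obtain ⟨a, ha⟩ := algebraicSolution_height_bound_holds
  -- the p-bounded exponent functions
  let b : ℕ → ℕ := fun n => 2 * ((m n + 1) * (a * m n)) + 2 * a + 2 * m n + n * n + 4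
  let r : ℕ → ℕ := fun n => 2 * (ℓ n + b n + 4)
  let C₀ : ℕ := ∑ j ∈ Finset.range n₀, constantFreeComplexity (perPoly (Fin j) ℤ)
  let s : ℕ → ℕ := fun n => (5 * q n ^ 3 + 6 * q n ^ 2 + 2 * q n) * m n + 3 * q n + C₀
  have hb : IsPBounded b := by
    refine IsPBounded.add_holds (IsPBounded.add_holds (IsPBounded.add_holds (IsPBounded.add_holds
      (IsPBounded.mul_holds (IsPBounded.const 2) (IsPBounded.mul_holds
        (IsPBounded.add_holds hm (IsPBounded.const 1))
        (IsPBounded.mul_holds (IsPBounded.const a) hm)))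
      (IsPBounded.const _)) (IsPBounded.mul_holds (IsPBounded.const 2) hm))
      (IsPBounded.mul_holds IsPBounded.id IsPBounded.id)) (IsPBounded.const 4)
  have hr : IsPBounded r :=
    IsPBounded.mul_holds (IsPBounded.const 2)
      (IsPBounded.add_holds (IsPBounded.add_holds hℓ hb) (IsPBounded.const 4))
  have hs : IsPBounded s := by
    refine IsPBounded.add_holds (IsPBounded.add_holds (IsPBounded.mul_holds
      (IsPBounded.add_holds (IsPBounded.add_holds
        (IsPBounded.mul_holds (IsPBounded.const 5) (IsPBounded.pow_holds hq 3))
        (IsPBounded.mul_holds (IsPBounded.const 6) (IsPBounded.pow_holds hq 2)))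
        (IsPBounded.mul_holds (IsPBounded.const 2) hq)) hm)
      (IsPBounded.mul_holds (IsPBounded.const 3) hq)) (IsPBounded.const _)
  refine ⟨r, s, hr, hs, fun n => ?_⟩
  by_cases hn : n₀ ≤ n
  · -- the rigid skeleton at `n`
    obtain ⟨μ, k, N, Q, A, pts, hμ, hQ2, hQc, hQs, hN, hNq, hcover, hexhaust⟩ := hn₀ n hn
    obtain ⟨p, hp, hpl, hpr, hc⟩ :=
      exists_prime_of_rigid_skeleton ha Q A pts hμ hQ2 hQc hQs hN hcover hexhaust (ℓ n)
    refine ⟨p, hp, hpl, hpr, hc.trans ?_⟩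
    show (5 * N ^ 3 + 6 * N ^ 2 + 2 * N) * m n + 3 * N ≤
      (5 * q n ^ 3 + 6 * q n ^ 2 + 2 * q n) * m n + 3 * q n + C₀
    have : (5 * N ^ 3 + 6 * N ^ 2 + 2 * N) * m n + 3 * N ≤
        (5 * q n ^ 3 + 6 * q n ^ 2 + 2 * q n) * m n + 3 * q n := by gcongr
    exact this.trans (Nat.le_add_right _ _)
  · -- small `n`: a Bertrand prime and the constant-free complexity of `per_n` over `ℤ`
    rw [not_le] at hn
    obtain ⟨p, hp, hlt, hle⟩ :=
      Nat.exists_prime_lt_and_le_two_mul (2 ^ ℓ n) (pow_ne_zero _ two_ne_zero)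
    refine ⟨p, hp, hlt, ?_, ?_⟩
    · calc p ≤ 2 * 2 ^ ℓ n := hle
        _ = 2 ^ (ℓ n + 1) := by rw [pow_succ]; ring
        _ ≤ 2 ^ r n := Nat.pow_le_pow_right two_pos (by show ℓ n + 1 ≤ 2 * (ℓ n + b n + 4); omega)
    · calc complexity (perPoly (Fin n) (ZMod p)) ≤ constantFreeComplexity (perPoly (Fin n) ℤ) :=
            complexity_perPoly_zmod_le_constantFree n p
        _ ≤ C₀ := Finset.single_le_sum (f := fun j => constantFreeComplexity (perPoly (Fin j) ℤ))
            (fun _ _ => Nat.zero_le _) (Finset.mem_range.mpr hn)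
        _ ≤ s n := Nat.le_add_left _ _

end DescentGlue

end Summit.ValiantsHypothesis.ValiantsHypothesis.Theorems.GaugeDescent

end
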